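import Summits.QuantumFields.BalabanUV.T4Continuum.Spine.NE1p.DressedRoot

/-!
# T⁴ programme, spine estimate NE1′ (node O3b/H2) — LEAF L-B OF THE DRESSED ROOT: THE BIRTH SUPPLIERS WIRED UNDER THE
# DRESSED BUDGET GATE (crew row S5 of the NE1′ formalisation swarm)

Cell `pub-balaban`, sub-cell `t4`, BINDER-OWNERS row NE1′ (owner lineage t4-ne1p-p1, skeleton `t4/skeletons/NE1p-t4-ne1p-p1.md`
v1.1 §2 leaf L-B ∕ §6 seat S5); swarm unit `b2b-balaban-t4-ne1p-formalise-leaf-05`; tree target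
`Summits/QuantumFields/BalabanUV/T4Continuum/Spine/NE1p/`; ADDITIVE — imports `Spine/NE1p/DressedRoot` ONLY, modifies nothing.

WHAT THIS FILE DOES.  The field `hbirth` of `DressedRoot.BookingLeaves U Bk T` — leaf L-B of END-B, wall items (w1)+(w5b) —
is the history-sourced birth shape of `T4TrajectoryComparison` §10 in the UNIFORM two-rate class and UNDER THE DRESSED BUDGET GATE:
  `T.BirthsFromOld U.C ρ (twoRate U.A₀ U.ρ₁ U.τ Bk.K) (budgetGate T s₀ U.m S U.C ρ)`.
Here it is CONCLUDED VERBATIM from each of the two supplier formats the owner names (skeleton §6 S5), plus the b02 seam: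
* §1 (w1) HISTORY-FREE BIRTHS at the first-order source rate — `T.BirthGen Â U.τ` (`gen b j ≤ Â·τ^{K−j}`) and the K-free
  amplitude inequality `U.C·Â ≤ U.A₀` ⟹ `hbirth` (`Trajectory.birthsFromOld_of_diag` BY NAME): «birth sizes `Â·τ^{K−j}` at birth».
* §2 (w5b) ABSORPTION BIRTHS — `T.AbsorbsFrom U.C ρ β A Sabs (budgetGate …)` («budgets add»: own dressing size `β j` plus `A ×`
  the envelopes of the absorbed strictly OLDER families `Sabs b`), a POSITIONAL count of the absorbed families
  `#{b₀ ∈ Sabs b : j_{b₀} = j₀} ≤ M₀·Λ^{j_b−j₀}`, dressing sizes `β j ≤ β₀·τ^{K−j}` and the K-FREE smallness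
  `β₀ + A·M₀·A₀·(1−ρ′)⁻¹ ≤ A₀` ⟹ `hbirth` (`Trajectory.birthsFromOld_prodRate_of_absorbsFrom_positional` BY NAME, the strict
  product `Λρ₁τ ≤ ρ′ < 1` of `UniformConstants` dominating the age sum): «absorption constant `A` at mergers».  Also the fan-in
  (card) form, and the LIVE-FAMILY form in which the absorbed families are among the live families `S (j_b) b` of the met
  component, so that the leaf's own positional count `hcount` (`N₀Λ^{k−j}`) IS the count (`M₀ = N₀`).
* §3 the (w5) ℝ-seam: row O3.E-iii-c's absorption DATA `R : T4PreservedUnderR.RStep Bk` with `T.PreBelowEnv R …` (pre-ℝ sizes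
  below the transported envelope, under the dressed gate) and `T.AbsorbLaw R …` ⟹ `hbirth` (`Trajectory.absorbsFrom_of_rstep`,
  `RStep.absorbs_lt` BY NAME).
* §3b (v1.1) the same seam through the RE-CUT binder `T.PreBelowEnvSucc R …` (pre-ℝ sizes below the POST-STEP envelope —
  `T4TrajectoryComparison` §12, XREAD C-pv18g19-1 M1: THIS is the binder consumers supply; §3's `PreBelowEnv` form is its
  corollary through `PreBelowEnv.toSucc`) ⟹ `hbirth` (`Trajectory.absorbsFrom_of_preBelowEnvSucc` BY NAME).
* §0 dictionary: `DressedRoot.twoRate A₀ ρ₁ τ K = prodRate K A₀ (fun _ => ρ₁) τ` (constant step factor), diagonal `A₀·τ^{K−j}`.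
(v1.2: DOCFIX only — the B15 bib key in the HONEST FRAMING paragraph corrected to `Balaban1989LargeFieldI`, crew XREAD C-ne1pleaf02-2
DOCFIX-1; all declarations byte-identical.  Followers: `Spine/NE1p/DressedBirthFirstOrder` ((w1) in row O3.E-i′'s currency),
`Spine/NE1p/DressedBirthSuppliersFam` (the family door), `Spine/NE1p/DressedAbsorptionWindow`∕`DressedAbsorptionWitness` (leaf-02:
the admissible region of the (w5b) smallness and its non-vacuity).)
So L-B reads «birth sizes `Â·τ^{K−j}` at birth, absorption constant `A` at mergers» and nothing else: the (w1) estimate (the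
first-order size of the cell's D-terms at birth, row O3.E-i′) and the (w5b) smallness of the absorption constant against fan-out
REMAIN DISPLAYED BINDERS (`hgen`∕`hAhat`, `habs`∕`hsmall`); the history-free case is the absorption format with `Sabs ≡ ∅`
(`absorbsFrom_of_birthGen`).

HONEST FRAMING.  [folklore] kernel bookkeeping over HYPOTHESIS SHAPES; 0 sorry; 0 citations used as facts; NO `def … : Prop`
minted; nothing of Bałaban's densities or the cell's D-terms is asserted — printed loci ([Balaban1989LargeFieldII] (1.69) p. 377
«budgets add», (1.64)–(1.68) pp. 375–377; [Balaban1989LargeFieldI] Prop. 1 p. 194, (1.100)–(1.102) p. 201) are CONTEXT for the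
binders, never hypothesis-free facts.  Headline: «L-B ⇐ the named binders», NEVER «NE1′ proved»; NE1′ is NOT PRINTED and NOT
PROVED; 0 of the binders is instantiated on Bałaban's densities; spine PROVED 0∕9 unchanged.  Rung (B)+1 on ONE finite
four-torus — NOT infinite volume, NOT a mass gap, NOT the Clay problem, NOT summit progress.  HONEST DEPENDENCY: continuum YM on
T⁴ ⇐ BetaPertH ∧ nine spine estimates (0/9 proved); BetaPertH ⇐ (D1) ∧ (D4) ∧ CAP+tail; G-an2-4 gates asym, D1 and NE2/3/4.
-/

noncomputable section

namespace Summit.QuantumFields.BalabanUV.T4Continuum.NE1p.DressedBirthSuppliers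

open Finset
open scoped BigOperators
open Literature.MathematicalPhysics.QuantumFieldTheory.Balaban1983to89
open Literature.MathematicalPhysics.QuantumFieldTheory.Balaban1983to89.T4TermFormat
open Literature.MathematicalPhysics.QuantumFieldTheory.Balaban1983to89.T4TermFormat.Booking
open Literature.MathematicalPhysics.QuantumFieldTheory.Balaban1983to89.T4TrajectoryComparison
open Literature.MathematicalPhysics.QuantumFieldTheory.Balaban1983to89.T4PreservedUnderR (RStep)
open Summit.QuantumFields.BalabanUV.T4Continuum.T4TrajectoryDensityDressed
open Summit.QuantumFields.BalabanUV.T4Continuum.NE1p.DressedRoot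

variable {Bk : T4TermFormat.Booking} {T : Trajectory Bk}

/-! ## §0 Dictionary: the uniform class is the product-rate class with a constant step factor -/

/-- The root's two-rate class `σ j k = A₀·ρ₁^{k−j}·τ^{K−j}` IS `T4TrajectoryComparison.prodRate K A₀ (fun _ => ρ₁) τ`
(`prodRate_const` BY NAME; the two `twoRate`s of the tree agree definitionally). [arith] [folklore] -/
theorem twoRate_eq_prodRate (A₀ ρ₁ τ : ℝ) (K : ℕ) : twoRate A₀ ρ₁ τ K = prodRate K A₀ (fun _ => ρ₁) τ := by
  funext j k
  rw [prodRate_const]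
  rfl

/-- The diagonal of the class — the room for a birth of scale `j`: `σ j j = A₀·τ^{K−j}`. [arith] [folklore] -/
theorem twoRate_diag (A₀ ρ₁ τ : ℝ) (K j : ℕ) : twoRate A₀ ρ₁ τ K j j = A₀ * τ ^ (K - j) := by
  simp [twoRate]

/-! ## §1 (w1) History-free births at the first-order source rate feed the birth slot -/

/-- **SUPPLIER (w1), any gate**: births of size `gen b j ≤ Â·τ^{K−j}` (`BirthGen`, row O3.E-i′'s format) with `C·Â ≤ A₀` lie on the
diagonal of the uniform class, hence meet the history-sourced birth shape under ANY gate (`birthsFromOld_of_diag` BY NAME).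
[folklore] -/
theorem birthsFromOld_twoRate_of_birthGen {C A₀ ρ₁ τ Ahat : ℝ} {ρ : ℕ → ℝ} {Gate : ℕ → Prop}
    (hC : 0 ≤ C) (hτ : 0 ≤ τ) (hgen : T.BirthGen Ahat τ) (hAhat : C * Ahat ≤ A₀) :
    T.BirthsFromOld C ρ (twoRate A₀ ρ₁ τ Bk.K) Gate := by
  refine Trajectory.birthsFromOld_of_diag fun b => ?_
  rw [twoRate_diag]
  calc C * T.gen b (Bk.birthScale b) ≤ C * (Ahat * τ ^ (Bk.K - Bk.birthScale b)) :=
        mul_le_mul_of_nonneg_left (hgen b) hC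
    _ = C * Ahat * τ ^ (Bk.K - Bk.birthScale b) := by ring
    _ ≤ A₀ * τ ^ (Bk.K - Bk.birthScale b) := mul_le_mul_of_nonneg_right hAhat (pow_nonneg hτ _)

/-- **LEAF L-B FROM (w1) — the field `BookingLeaves.hbirth` VERBATIM**: with the uniform constants `U`, history-free births
`T.BirthGen Â U.τ` and the K-free amplitude inequality `U.C·Â ≤ U.A₀` give
`T.BirthsFromOld U.C ρ (twoRate U.A₀ U.ρ₁ U.τ Bk.K) (budgetGate T s₀ U.m S U.C ρ)` for every rate profile `ρ`, action margins
`s₀` and live-family data `S` of the leaf bundle.  «Birth sizes `Â·τ^{K−j}` at birth» — nothing else. [folklore] -/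
theorem hbirth_of_birthGen (U : UniformConstants) (T : Trajectory Bk) {Ahat : ℝ} (ρ : ℕ → ℝ) (s₀ : Bk.Birth → ℕ → ℝ)
    (S : ℕ → Bk.Birth → Finset Bk.Birth) (hgen : T.BirthGen Ahat U.τ) (hAhat : U.C * Ahat ≤ U.A₀) :
    T.BirthsFromOld U.C ρ (twoRate U.A₀ U.ρ₁ U.τ Bk.K) (budgetGate T s₀ U.m S U.C ρ) :=
  birthsFromOld_twoRate_of_birthGen U.hC U.hτ0 hgen hAhat

/-! ## §2 (w5b) Absorption births («budgets add») feed the birth slot under the dressed gate -/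

/-- The absorption format is monotone in the dressing sizes `β` (below the cutoff). [folklore] -/
theorem absorbsFrom_mono_β {C A : ℝ} {ρ β β' : ℕ → ℝ} {Sabs : Bk.Birth → Finset Bk.Birth} {Gate : ℕ → Prop}
    (h : T.AbsorbsFrom C ρ β A Sabs Gate) (hβ : ∀ j, j ≤ Bk.K → β j ≤ β' j) :
    T.AbsorbsFrom C ρ β' A Sabs Gate :=
  fun b hbK hran => (h b hbK hran).trans (add_le_add (hβ _ hbK) le_rfl)

/-- History-free births are the absorption format with nothing absorbed in effect: `BirthGen Â τ` gives `AbsorbsFrom` with dressing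
sizes `C·Â·τ^{K−j}` for ANY absorption constant `A ≥ 0` and ANY absorbed sets (their envelopes only add nonnegative room;
`C ≥ 0`, rates `≥ 0`). [folklore] -/
theorem absorbsFrom_of_birthGen {C A Ahat τ : ℝ} {ρ : ℕ → ℝ} {Sabs : Bk.Birth → Finset Bk.Birth} {Gate : ℕ → Prop}
    (hC : 0 ≤ C) (hρ : ∀ i, 0 ≤ ρ i) (hA : 0 ≤ A) (hgen : T.BirthGen Ahat τ) :
    T.AbsorbsFrom C ρ (fun j => C * Ahat * τ ^ (Bk.K - j)) A Sabs Gate := by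
  intro b _ _
  have hsum : 0 ≤ A * ∑ b₀ ∈ Sabs b, T.envVar C ρ b₀ (Bk.birthScale b) :=
    mul_nonneg hA (sum_nonneg fun b₀ _ => Trajectory.envVar_nonneg hC hρ b₀ _)
  calc C * T.gen b (Bk.birthScale b) ≤ C * (Ahat * τ ^ (Bk.K - Bk.birthScale b)) :=
        mul_le_mul_of_nonneg_left (hgen b) hC
    _ = C * Ahat * τ ^ (Bk.K - Bk.birthScale b) := by ring
    _ ≤ C * Ahat * τ ^ (Bk.K - Bk.birthScale b) + A * ∑ b₀ ∈ Sabs b, T.envVar C ρ b₀ (Bk.birthScale b) :=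
        le_add_of_nonneg_right hsum

/-- THE STRICT PRODUCT DOMINATES THE AGE SUM: `Λρ₁τ ≤ ρ′` (all factors `≥ 0`) gives
`Λ^{k−j}·(∏_{[j,k)} ρ₁)·τ^{k−j} ≤ 1·ρ′^{k−j}` — the `hdom` input of the positional absorption count with `M = 1`, `r = ρ′`.
[arith] [folklore] -/
theorem strictProduct_dom {Λ ρ₁ τ ρ' : ℝ} (hΛ : 0 ≤ Λ) (hρ₁ : 0 ≤ ρ₁) (hτ : 0 ≤ τ) (hprod : Λ * ρ₁ * τ ≤ ρ') (j k : ℕ) :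
    Λ ^ (k - j) * stepProd (fun _ => ρ₁) j k * τ ^ (k - j) ≤ 1 * ρ' ^ (k - j) := by
  rw [stepProd_const, one_mul, ← mul_pow, ← mul_pow]
  exact pow_le_pow_left₀ (by positivity) hprod _

/-- **SUPPLIER (w5b), FAN-IN FORM, any gate**: absorbed families strictly older and at most `η` of them per birth, no step factor
beating the source decay (`ρ₁τ ≤ 1`), and the diagonal absorbing the dressing plus `A·η` old diagonals
(`β j + A·η·A₀τ^{K−j} ≤ A₀τ^{K−j}`) ⟹ the birth shape in the uniform class (`birthsFromOld_prodRate_of_absorbsFrom_card` BY NAME).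
[folklore] -/
theorem birthsFromOld_twoRate_of_absorbsFrom_card {C A A₀ ρ₁ τ : ℝ} {ρ β : ℕ → ℝ} {Sabs : Bk.Birth → Finset Bk.Birth}
    {Gate : ℕ → Prop} {η : ℕ} (holder : ∀ b b₀, b₀ ∈ Sabs b → Bk.birthScale b₀ < Bk.birthScale b)
    (hcard : ∀ b, (Sabs b).card ≤ η) (hA : 0 ≤ A) (hA₀ : 0 ≤ A₀) (hρ₁ : 0 ≤ ρ₁) (hτ : 0 ≤ τ) (hρ₁τ : ρ₁ * τ ≤ 1)
    (h : T.AbsorbsFrom C ρ β A Sabs Gate)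
    (hβ : ∀ j, j ≤ Bk.K → β j + A * η * (A₀ * τ ^ (Bk.K - j)) ≤ A₀ * τ ^ (Bk.K - j)) :
    T.BirthsFromOld C ρ (twoRate A₀ ρ₁ τ Bk.K) Gate := by
  rw [twoRate_eq_prodRate]
  exact Trajectory.birthsFromOld_prodRate_of_absorbsFrom_card holder hcard hA hA₀ hτ (fun _ => hρ₁) (fun _ _ => hρ₁τ) h hβ

/-- **SUPPLIER (w5b), POSITIONAL FORM WITH K-FREE SMALLNESS, any gate**: absorbed families strictly older with the positional
fan-out count `#{b₀ ∈ Sabs b : j_{b₀} = j₀} ≤ M₀·Λ^{j_b−j₀}`, the strict product `Λρ₁τ ≤ ρ′ < 1`, dressing sizes at the source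
rate `β j ≤ β₀·τ^{K−j}`, and the K-FREE smallness `β₀ + A·M₀·A₀·(1−ρ′)⁻¹ ≤ A₀` ⟹ the birth shape in the uniform class
(`birthsFromOld_prodRate_of_absorbsFrom_positional` BY NAME with `M = 1`, `r = ρ′`: the absorbed classes of age `m` weigh
`(ρ₁τ)^m` against their number `Λ^m`, a geometric series in `ρ′`). [folklore] -/
theorem birthsFromOld_twoRate_of_absorbsFrom_positional {C A A₀ ρ₁ τ Λ ρ' M₀ β₀ : ℝ} {ρ β : ℕ → ℝ}
    {Sabs : Bk.Birth → Finset Bk.Birth} {Gate : ℕ → Prop}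
    (holder : ∀ b b₀, b₀ ∈ Sabs b → Bk.birthScale b₀ < Bk.birthScale b)
    (hcount : ∀ (b : Bk.Birth) (j₀ : ℕ),
      (((Sabs b).filter fun b₀ => Bk.birthScale b₀ = j₀).card : ℝ) ≤ M₀ * Λ ^ (Bk.birthScale b - j₀))
    (hA : 0 ≤ A) (hA₀ : 0 ≤ A₀) (hρ₁ : 0 ≤ ρ₁) (hτ : 0 ≤ τ) (hΛ : 0 ≤ Λ) (hM₀ : 0 ≤ M₀) (hρ'1 : ρ' < 1)
    (hprod : Λ * ρ₁ * τ ≤ ρ') (h : T.AbsorbsFrom C ρ β A Sabs Gate) (hβ : ∀ j, j ≤ Bk.K → β j ≤ β₀ * τ ^ (Bk.K - j))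
    (hsmall : β₀ + A * M₀ * A₀ * (1 - ρ')⁻¹ ≤ A₀) :
    T.BirthsFromOld C ρ (twoRate A₀ ρ₁ τ Bk.K) Gate := by
  have hρ'0 : 0 ≤ ρ' := le_trans (by positivity) hprod
  rw [twoRate_eq_prodRate]
  refine Trajectory.birthsFromOld_prodRate_of_absorbsFrom_positional (M := 1) (r := ρ') holder hcount hA hA₀ hτ
    (fun _ => hρ₁) hM₀ zero_le_one hρ'0 hρ'1 (fun j k _ _ => strictProduct_dom hΛ hρ₁ hτ hprod j k)
    (absorbsFrom_mono_β h hβ) fun j _ => ?_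
  have hτp : 0 ≤ τ ^ (Bk.K - j) := pow_nonneg hτ _
  calc β₀ * τ ^ (Bk.K - j) + A * (M₀ * A₀ * 1 * (1 - ρ')⁻¹ * τ ^ (Bk.K - j))
      = (β₀ + A * M₀ * A₀ * (1 - ρ')⁻¹) * τ ^ (Bk.K - j) := by ring
    _ ≤ A₀ * τ ^ (Bk.K - j) := mul_le_mul_of_nonneg_right hsmall hτp

/-- **LEAF L-B FROM (w5b) — the field `BookingLeaves.hbirth` VERBATIM**: with the uniform constants `U` (its strict product
`Λρ₁τ ≤ ρ′ < 1` dominating the age sum), absorption births UNDER THE DRESSED BUDGET GATE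
`T.AbsorbsFrom U.C ρ β A Sabs (budgetGate T s₀ U.m S U.C ρ)` with strictly older absorbed families counted positionally by
`M₀·U.Λ^{j_b−j₀}`, dressing sizes `β j ≤ β₀·U.τ^{K−j}` and the K-FREE smallness `β₀ + A·M₀·U.A₀·(1−U.ρ′)⁻¹ ≤ U.A₀` give `hbirth`.
«Absorption constant `A` at mergers» — nothing else. [folklore] -/
theorem hbirth_of_absorbsFrom (U : UniformConstants) (T : Trajectory Bk) (ρ : ℕ → ℝ) (s₀ : Bk.Birth → ℕ → ℝ)
    (S : ℕ → Bk.Birth → Finset Bk.Birth) {Sabs : Bk.Birth → Finset Bk.Birth} {β : ℕ → ℝ} {A M₀ β₀ : ℝ}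
    (holder : ∀ b b₀, b₀ ∈ Sabs b → Bk.birthScale b₀ < Bk.birthScale b)
    (hcount : ∀ (b : Bk.Birth) (j₀ : ℕ),
      (((Sabs b).filter fun b₀ => Bk.birthScale b₀ = j₀).card : ℝ) ≤ M₀ * U.Λ ^ (Bk.birthScale b - j₀))
    (hA : 0 ≤ A) (hM₀ : 0 ≤ M₀) (habs : T.AbsorbsFrom U.C ρ β A Sabs (budgetGate T s₀ U.m S U.C ρ))
    (hβ : ∀ j, j ≤ Bk.K → β j ≤ β₀ * U.τ ^ (Bk.K - j)) (hsmall : β₀ + A * M₀ * U.A₀ * (1 - U.ρ')⁻¹ ≤ U.A₀) :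
    T.BirthsFromOld U.C ρ (twoRate U.A₀ U.ρ₁ U.τ Bk.K) (budgetGate T s₀ U.m S U.C ρ) :=
  birthsFromOld_twoRate_of_absorbsFrom_positional holder hcount hA U.hA₀ U.hρ₁ U.hτ0 U.hΛ hM₀ U.hρ'1 U.hprod habs hβ
    hsmall

/-- THE ABSORBED FAMILIES AMONG THE LIVE ONES ARE COUNTED BY THE LEAF'S OWN POSITIONAL COUNT: if the absorbed (strictly older)
families of `b` are among the live families `S (j_b) b` of its met component at its birth scale, the positional count of the
live families (`BookingLeaves.hcount`'s type, `N₀Λ^{k−j}`) bounds the absorbed ones per birth scale by `N₀·Λ^{j_b−j₀}` (empty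
above `j_b` by olderness). [folklore] -/
theorem count_absorbed_of_live {N₀ Λ : ℝ} {S : ℕ → Bk.Birth → Finset Bk.Birth} {Sabs : Bk.Birth → Finset Bk.Birth}
    (hN₀ : 0 ≤ N₀) (hΛ : 0 ≤ Λ) (holder : ∀ b b₀, b₀ ∈ Sabs b → Bk.birthScale b₀ < Bk.birthScale b)
    (hsub : ∀ b, Sabs b ⊆ S (Bk.birthScale b) b)
    (hcountS : ∀ k b, ∀ j ≤ k, (((S k b).filter fun f => Bk.birthScale f = j).card : ℝ) ≤ N₀ * Λ ^ (k - j)) :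
    ∀ (b : Bk.Birth) (j₀ : ℕ),
      (((Sabs b).filter fun b₀ => Bk.birthScale b₀ = j₀).card : ℝ) ≤ N₀ * Λ ^ (Bk.birthScale b - j₀) := by
  intro b j₀
  by_cases hj : j₀ ≤ Bk.birthScale b
  · exact le_trans (by exact_mod_cast card_le_card (filter_subset_filter _ (hsub b))) (hcountS _ b j₀ hj)
  · have hempty : ((Sabs b).filter fun b₀ => Bk.birthScale b₀ = j₀) = ∅ := by
      refine filter_eq_empty_iff.mpr fun b₀ hb₀ h0 => hj ?_
      rw [← h0]
      exact (holder b b₀ hb₀).le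
    rw [hempty, card_empty, Nat.cast_zero]
    positivity

/-- **LEAF L-B FROM (w5b), LIVE-FAMILY FORM — `BookingLeaves.hbirth` VERBATIM from `BookingLeaves.hcount`'s own count**: absorbed
families strictly older and among the live families of the met component at the birth scale, the leaf's positional count
`N₀Λ^{k−j}`, absorption under the dressed gate, dressing sizes `β j ≤ β₀·τ^{K−j}` and the K-FREE smallness
`β₀ + A·N₀·A₀·(1−ρ′)⁻¹ ≤ A₀` (compare `UniformConstants.hsmall`: `m·N₀A₀(1−ρ′)⁻¹ ≤ 1 − s̄⁰`) ⟹ `hbirth`. [folklore] -/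
theorem hbirth_of_absorbsFrom_live (U : UniformConstants) (T : Trajectory Bk) (ρ : ℕ → ℝ) (s₀ : Bk.Birth → ℕ → ℝ)
    (S : ℕ → Bk.Birth → Finset Bk.Birth) {Sabs : Bk.Birth → Finset Bk.Birth} {β : ℕ → ℝ} {A β₀ : ℝ}
    (holder : ∀ b b₀, b₀ ∈ Sabs b → Bk.birthScale b₀ < Bk.birthScale b) (hsub : ∀ b, Sabs b ⊆ S (Bk.birthScale b) b)
    (hcountS : ∀ k b, ∀ j ≤ k, (((S k b).filter fun f => Bk.birthScale f = j).card : ℝ) ≤ U.N₀ * U.Λ ^ (k - j))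
    (hA : 0 ≤ A) (habs : T.AbsorbsFrom U.C ρ β A Sabs (budgetGate T s₀ U.m S U.C ρ))
    (hβ : ∀ j, j ≤ Bk.K → β j ≤ β₀ * U.τ ^ (Bk.K - j)) (hsmall : β₀ + A * U.N₀ * U.A₀ * (1 - U.ρ')⁻¹ ≤ U.A₀) :
    T.BirthsFromOld U.C ρ (twoRate U.A₀ U.ρ₁ U.τ Bk.K) (budgetGate T s₀ U.m S U.C ρ) :=
  hbirth_of_absorbsFrom U T ρ s₀ S holder (count_absorbed_of_live U.hN₀ U.hΛ holder hsub hcountS) hA U.hN₀ habs hβ hsmall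

/-! ## §3 The (w5) ℝ-seam: row O3.E-iii-c's absorption data feed the birth slot under the dressed gate -/

/-- **LEAF L-B FROM THE ℝ-STEP SEAM — `BookingLeaves.hbirth` VERBATIM**: the absorption DATA of a later ℝ-step
`R : RStep Bk` (`R.absorbs`, strictly older by `RStep.absorbs_lt`), the pre-ℝ sizes below the transported envelope under the
dressed gate (`T.PreBelowEnv R U.C ρ (budgetGate …)`), the absorption law `T.AbsorbLaw R U.C β A` (from `RStep.Absorbs A` by
`absorbLaw_of_absorbs`), a positional count of `R.absorbs`, dressing sizes `β j ≤ β₀·τ^{K−j}` and the K-FREE smallness ⟹ `hbirth`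
(`Trajectory.absorbsFrom_of_rstep` BY NAME, then §2). [folklore] -/
theorem hbirth_of_rstep (U : UniformConstants) (T : Trajectory Bk) (R : RStep Bk) (ρ : ℕ → ℝ) (s₀ : Bk.Birth → ℕ → ℝ)
    (S : ℕ → Bk.Birth → Finset Bk.Birth) {β : ℕ → ℝ} {A M₀ β₀ : ℝ}
    (hcount : ∀ (b : Bk.Birth) (j₀ : ℕ),
      (((R.absorbs b).filter fun b₀ => Bk.birthScale b₀ = j₀).card : ℝ) ≤ M₀ * U.Λ ^ (Bk.birthScale b - j₀))
    (hA : 0 ≤ A) (hM₀ : 0 ≤ M₀) (hpre : T.PreBelowEnv R U.C ρ (budgetGate T s₀ U.m S U.C ρ))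
    (hlaw : T.AbsorbLaw R U.C β A) (hβ : ∀ j, j ≤ Bk.K → β j ≤ β₀ * U.τ ^ (Bk.K - j))
    (hsmall : β₀ + A * M₀ * U.A₀ * (1 - U.ρ')⁻¹ ≤ U.A₀) :
    T.BirthsFromOld U.C ρ (twoRate U.A₀ U.ρ₁ U.τ Bk.K) (budgetGate T s₀ U.m S U.C ρ) :=
  hbirth_of_absorbsFrom U T ρ s₀ S (fun b b₀ hb₀ => R.absorbs_lt b b₀ hb₀) hcount hA hM₀
    (Trajectory.absorbsFrom_of_rstep R U.hC hA hpre hlaw) hβ hsmall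

/-! ## §3b (v1.1) The ℝ-seam through the RE-CUT binder `PreBelowEnvSucc` (the one consumers supply) -/

/-- **LEAF L-B FROM THE ℝ-STEP SEAM, RE-CUT BINDER — `BookingLeaves.hbirth` VERBATIM**: as `hbirth_of_rstep`, but with the
pre-ℝ sizes below the POST-STEP envelope `envVar (k+1) = ρ k·envVar k + C·gen b (k+1)` (`T.PreBelowEnvSucc R U.C ρ (budgetGate …)`,
`T4TrajectoryComparison` §12 — the binder row O3.E-iii-c's suppliers actually meet, `preBelowEnvSucc_ofRenewal`; §3's
`PreBelowEnv` version is the corollary through `PreBelowEnv.toSucc`), the absorption law, a positional count of `R.absorbs`,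
dressing sizes `β j ≤ β₀·τ^{K−j}` and the K-FREE smallness `β₀ + A·M₀·A₀·(1−ρ′)⁻¹ ≤ A₀` ⟹ `hbirth`
(`Trajectory.absorbsFrom_of_preBelowEnvSucc`, `RStep.absorbs_lt` BY NAME, then §2). [folklore] -/
theorem hbirth_of_rstepSucc (U : UniformConstants) (T : Trajectory Bk) (R : RStep Bk) (ρ : ℕ → ℝ)
    (s₀ : Bk.Birth → ℕ → ℝ) (S : ℕ → Bk.Birth → Finset Bk.Birth) {β : ℕ → ℝ} {A M₀ β₀ : ℝ}
    (hcount : ∀ (b : Bk.Birth) (j₀ : ℕ),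
      (((R.absorbs b).filter fun b₀ => Bk.birthScale b₀ = j₀).card : ℝ) ≤ M₀ * U.Λ ^ (Bk.birthScale b - j₀))
    (hA : 0 ≤ A) (hM₀ : 0 ≤ M₀) (hpre : T.PreBelowEnvSucc R U.C ρ (budgetGate T s₀ U.m S U.C ρ))
    (hlaw : T.AbsorbLaw R U.C β A) (hβ : ∀ j, j ≤ Bk.K → β j ≤ β₀ * U.τ ^ (Bk.K - j))
    (hsmall : β₀ + A * M₀ * U.A₀ * (1 - U.ρ')⁻¹ ≤ U.A₀) :
    T.BirthsFromOld U.C ρ (twoRate U.A₀ U.ρ₁ U.τ Bk.K) (budgetGate T s₀ U.m S U.C ρ) :=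
  hbirth_of_absorbsFrom U T ρ s₀ S (fun b b₀ hb₀ => R.absorbs_lt b b₀ hb₀) hcount hA hM₀
    (Trajectory.absorbsFrom_of_preBelowEnvSucc R hA hpre hlaw) hβ hsmall

/-- §3's `hbirth_of_rstep` IS the corollary of the re-cut form (`PreBelowEnv.toSucc` with `U.hC`) — the record that the two
seam forms agree. [folklore] -/
example (U : UniformConstants) (T : Trajectory Bk) (R : RStep Bk) (ρ : ℕ → ℝ) (s₀ : Bk.Birth → ℕ → ℝ)
    (S : ℕ → Bk.Birth → Finset Bk.Birth) {β : ℕ → ℝ} {A M₀ β₀ : ℝ}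
    (hcount : ∀ (b : Bk.Birth) (j₀ : ℕ),
      (((R.absorbs b).filter fun b₀ => Bk.birthScale b₀ = j₀).card : ℝ) ≤ M₀ * U.Λ ^ (Bk.birthScale b - j₀))
    (hA : 0 ≤ A) (hM₀ : 0 ≤ M₀) (hpre : T.PreBelowEnv R U.C ρ (budgetGate T s₀ U.m S U.C ρ))
    (hlaw : T.AbsorbLaw R U.C β A) (hβ : ∀ j, j ≤ Bk.K → β j ≤ β₀ * U.τ ^ (Bk.K - j))
    (hsmall : β₀ + A * M₀ * U.A₀ * (1 - U.ρ')⁻¹ ≤ U.A₀) :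
    T.BirthsFromOld U.C ρ (twoRate U.A₀ U.ρ₁ U.τ Bk.K) (budgetGate T s₀ U.m S U.C ρ) :=
  hbirth_of_rstepSucc U T R ρ s₀ S hcount hA hM₀ (hpre.toSucc U.hC) hlaw hβ hsmall

end Summit.QuantumFields.BalabanUV.T4Continuum.NE1p.DressedBirthSuppliers

end
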